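/-
Origin: expansion seat `planner-pub-hodgecm-prl1-g5-0`, handover #2 2026-08-18T09:18:29Z (`HOME/pub-hodgecm-prl1-g5/lean/Prl1g5/SignRecipeEndState.lean`, md5 4a904783, 165 lines);
landed by the gen-7 packager in gate run 27 as `HodgeCM/Automorphic/SignRecipeEndState.lean` (import ^import Prl1g4\.→import HodgeCM.Automorphic. ×1; import ^import Prl1g5\.→import HodgeCM.Automorphic. ×1).
-/
/-
Origin: HOME/pub-hodgecm-prl1-g5/lean/Prl1g5/SignRecipeEndState.lean — session planner-pub-hodgecm-prl1-g5-0
(unit pub-hodgecm-prl1-g5, EXPANSION PROVER a-1 gen 5 on `Universe.RealisationExistsPerL / RealisationExistsFace`,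
STRATEGY 1 = CONSTRUCT).  Intended final place: `HodgeCM/Automorphic/SignRecipeEndState.lean`.
Imports at landing: `Prl1g4.AdelicTorusResidual` ↦ `HodgeCM.Automorphic.AdelicTorusResidual` (prl1-g4 #9, run 27),
`Prl1g5.SignRecipe` ↦ `HodgeCM.Automorphic.SignRecipe` (this seat's #1).
-/
import Summits.HodgeConjecture.HodgeCM.Automorphic.AdelicTorusResidual
import Summits.HodgeConjecture.HodgeCM.Automorphic.SignRecipe_2

/-!
# END STATE of part (a) with PerL's sign recipe BUILT IN — `ThetaModel.Inputs` 10 → 8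

prl1-g4's END STATE `Assembly.realisationExists_ofSideData` (file `AdelicTorusResidual`) quantifies over the core
DATA `AdelicTorusCore hP = (emb, cover, kappa, frameSign, wm, Theta)` and the TEN theta inputs
`ThetaModel.Inputs` of the resulting model, two of which (`kappaConj`, `frameSignConj`) are DESIGN constraints on
the free sign data `kappa`, `frameSign`.  Here the sign data are no longer free: they ARE PerL's recipe
(`HodgeCM.SignRecipe.kappa h`, `HodgeCM.SignRecipe.frameSign` of `HodgeCM.Automorphic.SignRecipe`, v5 (eq:Psit)
ll. 61–65 + l. 51 + Lemma 3.3(a) l. 284), and the two design inputs are THEOREMS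
(`SignRecipe.kappa_conjugate`, `SignRecipe.frameSign_conjugate`).

* `Universe.AdelicThetaCore hP` — the four remaining DATA fields `emb`, `cover`, `wm`, `Theta`;
  `AdelicThetaCore.toCore h : U.AdelicTorusCore hP` fills in the recipe (`h : Bool` = PerL's `φ^h ∈ {1, c}`,
  [Y1neg] v2 Lemma 4.2 — the one convention bit of (eq:Phiprime) l. 100).
* `Assembly.realisationExists_ofSignRecipe (M) (hP) (h) (C : U.AdelicThetaCore hP) (d12 d34) (A : NonDesignInputs)
  (hHR) : U.RealisationExistsPerL ∧ U.RealisationExistsFace` (+ `perL_ofSignRecipe`, `COR_CM_endState_ofSignRecipe`).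

Hypotheses of the realisation cone after this file: model facts `M`; the compactness criterion `hP` [PRINT,
Margulis 1991 I.3.2.1(b)]; DATA `C = (emb, cover, wm, Theta)` and the bit `h`; per context the torus-side DATA
`d12 c, d34 c : SideData` (archimedean types + allowed-pair predicates, no hypothesis); the EIGHT non-design inputs
`ThetaModel.NonDesignInputs` = PRINT `embCover`, `innerEmb` + OPEN `thetaSub` (N12), `thetaWedge` (N33), `thetaGen12`
(N19w), `thetaReal34` (N19g), `chars` (N31), `occ` (N29); Hodge–Riemann `hHR`.  The sign recipe and its two design
inputs are GONE (constructed / proved).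
-/

noncomputable section

open scoped TensorProduct InnerProductSpace

namespace HodgeCM

namespace Universe

open HodgeCM.PerL34 HodgeCM.PerL34.Annihilation HodgeCM.Adelic
open HodgeCM.Prior.Perl34File HodgeCM.Prior.Perl34File.Perl34

variable (U : Universe)

/-- **The core DATA of the realisation cone once the sign recipe is constructed**: prl1-g4's `AdelicTorusCore hP`
minus `kappa`, `frameSign` — degree-two classes as `L²` functions on `[G_U]` (`emb`), the coverings (`cover`), the
Weil theta model of each context over the adelic unitary groups (`wm`), the theta one-forms (`Theta`). -/
structure AdelicThetaCore (hP : PrintFact_unitaryCompact) where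
  /-- degree-two classes of `P_Γ` as `L²` functions on `[G_U]` -/
  emb : ∀ {L : CMField} {ι₁ : L →+* ℂ} {V : HermSpace3 L ι₁} (Γ : Level V),
    U.CohC (U.pms L ι₁ V Γ) 2 →ₗ[ℂ] (V.latticeModel hP).toQuotientModel.H
  /-- the covering `P_{Γ'} → P_Γ` for `Γ' ≤ Γ` -/
  cover : ∀ {L : CMField} {ι₁ : L →+* ℂ} {V : HermSpace3 L ι₁} (Γ Γ' : Level V),
    Γ'.Γ ≤ Γ.Γ → U.Mor (U.pms L ι₁ V Γ') (U.pms L ι₁ V Γ)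
  /-- the Weil theta model of the context, over the adelic unitary groups -/
  wm : ∀ {L : CMField} {ι₁ : L →+* ℂ} (V : HermSpace3 L ι₁) (c : SeesawCtx L),
    WeilThetaModel (V.latticeModel hP).toQuotientModel.G (V.latticeModel hP).toQuotientModel.Γ
      (c.D.latticeModelW hP).toQuotientModel.G (c.D.latticeModelW hP).toQuotientModel.Γ
  /-- the theta one-forms of type `Ψ_i` at level `Γ` -/
  Theta : ∀ {L : CMField} {ι₁ : L →+* ℂ} (V : HermSpace3 L ι₁), SeesawCtx L → Fin 4 → ∀ Γ : Level V,
    Set (U.CohC (U.pms L ι₁ V Γ) 1)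

namespace AdelicThetaCore

variable {U} {hP : PrintFact_unitaryCompact} (C : U.AdelicThetaCore hP)

/-- **The full core with PerL's sign recipe filled in** (`h` = `φ^h ∈ {1, c}`). -/
def toCore (h : Bool) : U.AdelicTorusCore hP where
  emb := C.emb
  cover := C.cover
  kappa := SignRecipe.kappa h
  frameSign := SignRecipe.frameSign
  wm := C.wm
  Theta := C.Theta

/-- (Ported verbatim from the HodgeCMPerL package; no docstring in the source.) -/
@[simp] theorem toCore_kappa (h : Bool) : (C.toCore h).kappa = SignRecipe.kappa h := rfl
/-- (Ported verbatim from the HodgeCMPerL package; no docstring in the source.) -/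
@[simp] theorem toCore_frameSign (h : Bool) : (C.toCore h).frameSign = SignRecipe.frameSign := rfl

variable (h : Bool) (d12 d34 : ∀ {L : CMField}, SeesawCtx L → SideData L)

/-- The theta model of the END STATE reached from the core, the bit and the side data. -/
abbrev thetaModel : U.ThetaModel :=
  ThetaModel.ofRegCarrier ((C.toCore h).rtc ((C.toCore h).side12 d12) ((C.toCore h).side34 d34))
    ((C.toCore h).analyticKM ((C.toCore h).side12 d12) ((C.toCore h).side34 d34)).toAnalytic

/-- Its `κ` IS PerL's recipe (definitionally, through the whole carrier chain). -/
theorem thetaModel_kappa : (C.thetaModel h d12 d34).kappa = SignRecipe.kappa h := rfl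

/-- Its frame sign IS PerL's (definitionally). -/
theorem thetaModel_frameSign : (C.thetaModel h d12 d34).frameSign = SignRecipe.frameSign := rfl

/-- **`Design_kappaConj` of the END STATE's theta model — a THEOREM.** -/
theorem design_kappaConj : (C.thetaModel h d12 d34).Design_kappaConj :=
  (C.thetaModel h d12 d34).design_kappaConj_of_eq h (C.thetaModel_kappa h d12 d34)

/-- **`Design_frameSignConj` of the END STATE's theta model — a THEOREM.** -/
theorem design_frameSignConj : (C.thetaModel h d12 d34).Design_frameSignConj :=
  (C.thetaModel h d12 d34).design_frameSignConj_of_eq (C.thetaModel_frameSign h d12 d34)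

/-- The ten inputs of the END STATE's theta model from the eight non-design ones. -/
theorem inputs_of_nonDesign (A : (C.thetaModel h d12 d34).NonDesignInputs) : (C.thetaModel h d12 d34).Inputs :=
  A.toInputs (C.design_kappaConj h d12 d34) (C.design_frameSignConj h d12 d34)

/-- For the END STATE's theta model the ten inputs ARE the eight non-design inputs. -/
theorem inputs_iff_nonDesign : (C.thetaModel h d12 d34).Inputs ↔ (C.thetaModel h d12 d34).NonDesignInputs :=
  (C.thetaModel h d12 d34).inputs_iff_of_signRecipe h (C.thetaModel_kappa h d12 d34)
    (C.thetaModel_frameSign h d12 d34)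

end AdelicThetaCore

end Universe

/-! ### END STATE -/

namespace Assembly

open HodgeCM.PerL34
open HodgeCM.Prior.Perl34File HodgeCM.Prior.Perl34File.Perl34
open HodgeCM.Universe (AdelicThetaCore AdelicTorusCore SideData ThetaModel)

variable (U : Universe)

/-- **Both realisation inputs of part (a) — `RealisationExistsPerL ∧ RealisationExistsFace` — with PerL's SIGN RECIPE
CONSTRUCTED.**  Hypotheses: the model facts `M`; the compactness criterion `hP` [PRINT, Margulis 1991 I.3.2.1(b)];
PerL's convention bit `h` (`φ^h ∈ {1, c}`); the core DATA `C` (`emb`, `cover`, Weil theta models, theta one-forms —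
NO sign data); per context the torus-side DATA `d12 c`, `d34 c`; the EIGHT non-design theta inputs (2 PRINT + 6
OPEN); Hodge–Riemann.  Versus prl1-g4's `realisationExists_ofSideData`: `kappa`, `frameSign` are no longer data and
`kappaConj`, `frameSignConj` no longer inputs — they are `SignRecipe.kappa h`, `SignRecipe.frameSign` and the
theorems `SignRecipe.kappa_conjugate`, `SignRecipe.frameSign_conjugate`. -/
theorem realisationExists_ofSignRecipe (M : U.ModelAxioms) (hP : PrintFact_unitaryCompact) (h : Bool)
    (C : U.AdelicThetaCore hP) (d12 d34 : ∀ {L : CMField}, SeesawCtx L → SideData L)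
    (A : (C.thetaModel h d12 d34).NonDesignInputs) (hHR : U.Fact_hodgeRiemann20) :
    U.RealisationExistsPerL ∧ U.RealisationExistsFace :=
  realisationExists_ofSideData U M hP (C.toCore h) d12 d34 (C.inputs_of_nonDesign h d12 d34 A) hHR

/-- **PerL with the sign recipe constructed.** -/
theorem perL_ofSignRecipe (M : U.ModelAxioms) (hP : PrintFact_unitaryCompact) (h : Bool)
    (C : U.AdelicThetaCore hP) (d12 d34 : ∀ {L : CMField}, SeesawCtx L → SideData L)
    (A : (C.thetaModel h d12 d34).NonDesignInputs) (hHR : U.Fact_hodgeRiemann20) : U.PerL :=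
  perL_ofSideData U M hP (C.toCore h) d12 d34 (C.inputs_of_nonDesign h d12 d34 A) hHR

/-- **COR-CM, END STATE with the sign recipe constructed.** -/
theorem COR_CM_endState_ofSignRecipe (M : U.ModelAxioms) (h29 : U.Fact_weightSpan)
    (h30 : U.Fact_weightHodge) (hE : U.Qw8ExtProd) (hD : U.Qw8DualPushPull) (hMi : U.Qw8Milne)
    (hP : PrintFact_unitaryCompact) (h : Bool) (C : U.AdelicThetaCore hP)
    (d12 d34 : ∀ {L : CMField}, SeesawCtx L → SideData L)
    (A : (C.thetaModel h d12 d34).NonDesignInputs) (hHR : U.Fact_hodgeRiemann20) : U.HC_CM :=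
  COR_CM_endState_ofSideData U M h29 h30 hE hD hMi hP (C.toCore h) d12 d34 (C.inputs_of_nonDesign h d12 d34 A) hHR

/-- The old END STATE is recovered: any `AdelicTorusCore` whose sign data happen to be the recipe. -/
theorem realisationExists_ofSideData_of_signRecipe (M : U.ModelAxioms) (hP : PrintFact_unitaryCompact) (h : Bool)
    (C : U.AdelicThetaCore hP) (d12 d34 : ∀ {L : CMField}, SeesawCtx L → SideData L)
    (A : (C.thetaModel h d12 d34).Inputs) (hHR : U.Fact_hodgeRiemann20) :
    U.RealisationExistsPerL ∧ U.RealisationExistsFace :=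
  realisationExists_ofSignRecipe U M hP h C d12 d34 A.toNonDesign hHR

end Assembly

end HodgeCM

end
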